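import Mathlib
import HarnessLib
import HarnessLib.Audit
import Summits.KontsevichZagierPeriods.Statement
import Literature.NumberTheory.Transcendental.KZExpCalculus
import HarnessLib.Audit.Status.Attr

/-!
Route: ExpConservative

DORMANT since 2026-08-23T16:53:58Z (reconciler: no traction for 6.1 d (last activity statement-closed at 2026-08-17T13:00:53Z); parked, not closed — `ledger route dormant route-KontsevichZagierPeriods-ExpConservative --off` to reactivat) — unstaffed, not closed; items shared with open routes are served there. `ledger route dormant <id> --off` reactivates.

# Route ExpConservative — widen to the exponential KZ calculus: exponential kernel conjecture +
conservativity over KZ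

It suffices to show X := ExpKernelConjecture ∧ ExpConservativity for the LANDED exponential
Kontsevich–Zagier calculus `KZexp`
(Literature/NumberTheory/Transcendental/KZExpCalculus.lean; KontsevichZagierPeriods2001 §4.3):
representations [σ, f, g] with value
∫_σ e^{−g}·f (σ ⊆ ℝⁿ and f, g ℚ-semialgebraic, e^{−g}f absolutely integrable on σ), modulo five move
sets — (1a) additivity in the
domain, (1b) additivity in the integrand, (2) ℚ-semialgebraic injective change of variables
transporting f (with |det Φ′|) and g,
(3a) Newton–Leibniz along the last coordinate on bounded fibres with primitives F = Σ hᵢ·e^{−gᵢ}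
(hᵢ, gᵢ ℚ-semialgebraic),
(3b) improper Newton–Leibniz on half-infinite fibres in limit form — with the inclusion `KZexp.incl
: KZ.FormalRep →+ KZexp.FormalRep`
(g := 0), which is injective (incl_injective), value-preserving (eval_incl) and carries KZ relations
into exponential relations
(map_relations_le). ExpKernelConjecture (item ExpKernelConjecture) := every formal ℤ-combination of
exponential representations with
value 0 is an exponential relation (rules form of the exponential period conjecture);
ExpConservativity (item ExpConservativity) :=
∀ c : KZ.FormalRep, incl c ∈ KZexp.relations → c ∈ KZ.relations, i.e. KZexp.relations.comap incl =
KZ.relations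
(conservative_iff_comap_eq): a derivation between two honest period representations may detour
through exponential (Γ-type)
intermediates, and conservativity says the detour can always be removed.
Lean: `Literature.NumberTheory.Transcendental.KZexp.KernelConjecture ∧
Literature.NumberTheory.Transcendental.KZexp.Conservative`

## Assembly
KZ.eval c = 0 ⇒ KZexp.eval (incl c) = 0 (eval_incl) ⇒ incl c ∈ KZexp.relations (ExpKernelConjecture)
⇒ c ∈ KZ.relations
(ExpConservativity): this is the proved tree lemma `KZexp.kzKernelConjecture_of_conservative :
Conservative → KernelConjecture →
KZKernelConjecture`; and KZKernelConjecture ⇒ KontsevichZagierPeriods because r.value = r'.value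
gives KZ.eval ([r] − [r']) = 0
(map_sub, KZ.eval_of) and KZ.Equivalent r r' is [r] − [r'] ∈ KZ.relations (proved in tree:
KernelForm.kontsevichZagierPeriods_of_kzKernelConjecture,
Literature.Periods.kzKernelConjecture_imp; the composite
Literature.KZexp.kernelConjecture_and_conservative_imp in
Theorems/ExpConservativeAssembly.lean has exactly the type of item Assembly). Deciding theorem
(D-0027 §2.1):
`theorem closes (h₁ : ExpConservativity) (h₂ : ExpKernelConjecture) : KontsevichZagierPeriods` —
four lines, sorry-free, certified.
The rationality hypotheses of the summit are not used (the kernel form is uniform in the endpoints).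

Rationale: WHY THIS LINE. Many identities between honest periods are only KNOWN through the Γ-function, an
exponential period
(KontsevichZagierPeriods2001 §4.3) that is conjecturally not a period: Gauss multiplication gives
B(1/9,4/9)·B(5/9,7/9) = 2·3^{7/6}·π,
Chowla–Selberg, √π·√π = π. In the exponential calculus such identities have short move-proofs —
B(a,b)Γ(a+b) = Γ(a)Γ(b) is ONE change of
variables (u,v) ↦ (uv, u(1−v)) on e^{−x−y}x^{a−1}y^{b−1}, Γ(s+1) = sΓ(s) is one improper
Newton–Leibniz move — so Conjecture 1 for the
KZ calculus splits into the kernel conjecture for a RICHER calculus, where more structure is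
available as a guide (Fresán–Jossen
exponential motives FresanJossen2020, irregular Hodge filtration, Fourier/Laplace transform;
o-minimal definability of exponential
periods CommelinHabeggerHuber2020 = arXiv:2007.08280), plus CONSERVATIVITY of the rich calculus over
the poor one — the rules-level
analogue of the full faithfulness of classical Nori motives inside exponential motives
(FresanJossen2020 Thm 5.1.1, Cor 5.1.4:
the formal classical period algebra injects into the formal exponential one). Imported: exponential
motives/periods (arithmetic
geometry) as the dictionary [σ,f,g] ↔ (variety, form, potential), and proof theory of rewriting
systems (retractions, normal forms
graded by the semialgebraic weight) as the tool; in tree the zero-locus retraction [σ,f,g] ↦ [σ ∩ {g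
= 0}, f] already carries moves
(1a),(1b),(2) back to KZ (KZexp.conservative_nlFree), so all content sits in the Newton–Leibniz
moves (3a),(3b), where
1 = ∫₀^∞e^{−t}dt lets weight ≠ 0 detours enter any identity and no coefficient retraction exists
(e^{−c} ∉ ℚ̄). Conservativity
asserts no numerical transcendence and so evades the GPC-strength barrier, which the kernel conjunct
carries in full. No prior
route of this summit changes the calculus; the negatives index (1 refuted statement,
KinematicFormulas plane convexity) is unrelated.

RANKED CRUXES. The cruxes are exactly the two hypotheses of the deciding theorem `closes` (rev ≥ 11;
0544 re-badged support).
#0 ExpThesis (target) — X = ExpKernelConjecture ∧ ExpConservativity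
(stmt-KontsevichZagierPeriods-0290). (why it might fail: mod soundness (relations_le_ker_eval) X is
at least KZKernelConjecture — strictly stronger than the summit: it dies with any calculus-size
refutation of ExpKernelConjecture even if every period identity is KZ-derivable.)
[Literature.KZexp.kernelConjecture_and_conservative_imp,
Literature.NumberTheory.Transcendental.KZexp.kzKernelConjecture_of_conservative, FresanJossen2020
Conj 8.2.6 / Thm 5.1.1, KontsevichZagierPeriods2001 §4.3]
#2 ExpConservativity (crux, h₁ of closes) — conservativity of the exponential calculus over the KZ
calculus: a KZ formal combination that is an exponential relation after incl is a KZ relation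
(stmt-KontsevichZagierPeriods-0292 = the Prop
Literature.NumberTheory.Transcendental.KZexp.Conservative, a route statement registered [status:
open], nothing in print to discharge). [difficulty: open-problem] (why it might fail: its content is
exactly the weight-0 identities derived THROUGH weight ≠ 0 representations — 1 = ∫₀^∞e^{−t}dt lets
Γ-detours enter any identity and no coefficient retraction exists (e^{−c} ∉ ℚ̄; zeroLocusRetraction
fails exactly on (3a)/(3b)); mod soundness it is false only together with KZKernelConjecture, i.e.
with the summit.) Located by the route review (refuter rreview1, 2026-08-15, note on 0292): the
weight-0 instances of (3a) AND (3b) are KZ-derivable on paper (functional Lindemann–Weierstrass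
normal form for Σhᵢe^{−gᵢ}; compactifying change of variables on C¹ cells; KZ (3a) with the
fibrewise-limit primitive — inputs at named-fact level: definable limits, C¹ cell decomposition), so
the D4 caveat of the definition is dischargeable and the crux is 'no essential weight ≠ 0 detour'.
[Literature.NumberTheory.Transcendental.KZexp.Conservative,
Literature.NumberTheory.Transcendental.KZexp.conservative_of_kzKernelConjecture,
Literature.NumberTheory.Transcendental.KZexp.conservative_nlFree,
Literature.NumberTheory.Transcendental.KZexp.Conservative.of_retraction_of_subset, FresanJossen2020
Thm 5.1.1 / Prop 5.1.3 / Cor 5.1.4 (motivic shadow only), KontsevichZagierPeriods2001 §4.3]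
#3 ExpKernelConjecture (crux, h₂ of closes) — the exponential kernel conjecture in rules form: every
formal combination of exponential representations with value 0 is an exponential relation
(stmt-KontsevichZagierPeriods-0293; stated inline, Iff.rfl with
Literature.NumberTheory.Transcendental.KZexp.KernelConjecture). [difficulty: open-problem; standing
hypothesis] (why it might fail: rules-form exponential period conjecture for THIS 5-move calculus —
no product/Fubini move, one-representation NL boundary terms — so a true identity may be underivable
for calculus-size reasons (first tests: ExpGammaOneProbe 0532, ExpTriplicationAccessibleV3 0544);
GPC-strength barrier (implies KZKernelConjecture mod soundness). The earlier worry 'forces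
saturation 2c ∈ rel ⇒ c ∈ rel' is settled: FormalRep/relations are torsion-free (refuter evidence
Sat.lean on 0293).) [Literature.NumberTheory.Transcendental.KZexp.KernelConjecture,
Literature.NumberTheory.Transcendental.KZexp.relations_le_ker_eval,
Literature.NumberTheory.Transcendental.KZexp.improperNewtonLeibnizRel, FresanJossen2020 Conj 8.2.6 /
8.2.8, Prop 12.1.5, KontsevichZagierPeriods2001 §4.3,
Literature.Barriers.KontsevichZagierPeriods.kzConjecture_implies_oddZetaAlgIndep]

SUPPORT. #9 ExpTriplicationAccessibleV3 (support; was crux r4, re-badged 2026-08-16) — the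
Gauss-triplication pair of route Neg is KZexp-equivalent after incl
(stmt-KontsevichZagierPeriods-0544): a special case of #3 at one explicit c (the values agree:
GaussMultiplicationFormula n = 3, z = 1/9 plus reflexion; also implied by Neg 0312 via
KZexp.map_relations_le), not consumed by closes. Proof-path gap recorded by the route review: every
Γ-based move chain leaves a non-unit Γ-factor representation tensored on, and removing it is
π- /Γ-cancellation in KZexp (KernelConjecture-strength at this c), not a move — so it is the
informative probe of #3's calculus-size failure mode, hard, and a provable Γ-calibration would keep
the Γ-factor (to be filed only when someone works it).
[Literature.Analysis.SpecialFunctions.GaussMultiplicationFormula, AndrewsAskeyRoy1999 Thm 1.5.2,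
KZexp.improperNewtonLeibnizRel, KZexp.changeOfVariablesRel]
#9 ExpGammaOneProbe (support, provable-now) — ∫₀^∞ e^(−t) dt = ∫₀¹ 1 dt as a finite chain of the
five landed moves (stmt-KontsevichZagierPeriods-0532; one improperNewtonLeibnizRel move over a point
base + additivity; Lean witnesses in refuter notes). #9 ExpBetaGammaCalibrationV2 (support,
provable-now) — Γ(1/3)² ↔ Γ(2/3)B(1/3,1/3) by ONE exponential change of variables Φ(u,v) = (uv,
u(1−v)) (stmt-KontsevichZagierPeriods-0533). #9 ExpNotConservative (support) — the negative side of
#2 (stmt-KontsevichZagierPeriods-0535), realistic only as a conditional on a Neg additive invariant.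
#9 ExpThesisGlue (support, definitional) — ExpConservativity → ExpKernelConjecture → ExpThesis
(stmt-KontsevichZagierPeriods-14444). #1 Assembly (stmt-KontsevichZagierPeriods-0291) — X →
KontsevichZagierPeriods, proved in tree (Literature.KZexp.kernelConjecture_and_conservative_imp,
Theorems/ExpConservativeAssembly.lean); KernelImpliesStatement (0197, shared) closed proved. HYGIENE
(operator): the verbatim duplicates Assembly2 0529 (= 0291), 0528 (= 0290), 0530 (= 0292), 0531 (=
0293), 0294 = 0534 (= 0544), 0295 (= 0533) await an operator drop/close — planner drops bounce ('the
assembly item cannot be dropped', then route.multi-assembly); they carry no badge and no content.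

TWO-LAYER PLAN. Conservativity ⇐ (NF) normal form / retraction for (3a),(3b)-detours at weight ≠ 0:
grade move chains by the semialgebraic band weight on {f ≠ 0} (well-defined by functional
Lindemann–Weierstrass; exponent data move only through boundary values of band weights) and show
every chain between weight-0 ends is equivalent to one that never leaves weight 0 → (W0)
KZ-derivability of the weight-0 instances of (3a)/(3b) (on paper: L–W normal form, compactifying CoV
on C¹ cells, KZ (3a) with the fibrewise-limit primitive) → ExpConservativity; k = 2, depth 1, glue
'NF → W0 → Conservative'. Filed only after ExpGammaOneProbe / ExpBetaGammaCalibrationV2 close and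
show which NL instances the Γ-detours actually use.

KILL CRITERIA. ExpNotConservative proved — an explicit c : KZ.FormalRep with incl c ∈
KZexp.relations and c ∉ KZ.relations — closes
the route (`route close --reason refuted:ExpConservativity`); since soundness
KZexp.relations_le_ker_eval is discharged
(KZExpCalculusProofs.relations_le_ker_eval_holds) such a c has KZ.eval c = 0, so it ALSO refutes
KontsevichZagierPeriods itself
(KZExpCalculusProofs.not_kzKernelConjecture_of_not_conservative with
KZKernelConjectureForms.kzKernelConjecture_iff_isRational; hand to route Neg).
ExpKernelConjecture refuted by an additive invariant of the five move sets separating two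
equal-valued exponential representations (a
calculus-size refutation, e.g. on ExpGammaOneProbe or the triplication pair 0544) does NOT kill the
line: pivot = enlarge the calculus by a
definition addendum (product/tensor move with a fixed representation, multi-term boundary
representations) and re-file #3 and #2 over
relations⁺ ⊇ relations (kernel gets easier, conservativity harder). KZKernelConjecture proved by any
other route moots this one
(KZExpCalculusProofs.Conservative.of_kzKernelConjecture, and the summit follows directly).

NOT DECOMPOSED YET. Crux #2 is not split at this revision (the NF/W0 split above is foreseen, not
filed); crux #3 is a standing hypothesis
and is never decomposed here — its near-term movement is the probes 0532/0544 and the refutation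
side. No Γ-calibration-with-factor, no
Gauss-n=3-as-moves and no ExpPiCancellation statement is filed until 0544 is actually worked (route
review suggestion, deferred). Complex
weights (KZexpC, route WickWedge), weight lines (route WeightLine) and Fourier/Laplace moves are
outside this route.

CHEAPEST FALSIFIER. ExpGammaOneProbe (stmt-0532): write ∫₀^∞e^{−t}dt = ∫₀¹1 dt as a finite chain of
the five landed moves
(expected: one (3b) move with F = −e^{−t} over a point base, then bookkeeping); if instead an
additive invariant of the move sets
separates [(0,∞),1,t] from [(0,1),1,0], ExpKernelConjecture is false for calculus-size reasons and
the line pivots at once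
(definition addendum) before any effort is spent on #2. Cost: one prover or refuter session.

NUMBERS. B(1/9,4/9)·B(5/9,7/9) = 2·3^(7/6)·π = 22.6371282948… (Gauss multiplication n = 3 at 1/9 and
reflexion); Γ(1/3)² = Γ(2/3)·B(1/3,1/3) = 7.1767116727….

DEFINITION REQUESTS. None open: KZexp (wi-03686 with addendum wi-03872, improper Newton–Leibniz)
landed as
Literature/NumberTheory/Transcendental/KZExpCalculus.lean, with soundness and the unconditional
Conservative.of_kzKernelConjecture in
KZExpCalculusProofs.lean. Cone note (route-repair 2026-08-16): the two [status: open] Props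
KZexp.Conservative / KZexp.KernelConjecture in
that file ARE cruxes #2/#3 (not literature debt); KZKernelConjecture and KZPeriodConjecture' reach
the file-level cone only through the
operator-owned Statement.lean import of PeriodConjecture.lean, never as hypotheses (ledger deps
check: 0 unproved constants, staffable).

Novelty: NOVELTY (retriage 2026-08-14; search-before-claim: `lit search --hybrid` ×2, `lit search`
local+zbMATH+Crossref (OpenAlex/S2/arXiv 429 today), `lit frontier KontsevichZagierPeriods --since
2020`, `lit bridges --cross any`, `lit vsearch`, `lit read arxiv:2007.08280 --grep
'conservativ|fully faithful|classical period'` — 0 hits for a rules-level statement).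
Nearest prior art FOUND:
(1) FresanJossen2020 (ms. 2024-04-11, read by grounders; acq-00129) Thm 5.1.1 (= Thm 1.2.9) "ι :
M(k) → Mexp(k) is fully faithful and exact", Prop 5.1.3 (classical motives stable under subquotients
in Mexp), Cor 5.1.4 (Gexp(k) → G(k) faithfully flat ⇒ the formal classical period algebra INJECTS
into the formal exponential one) — the MOTIVIC shadow of crux Conservative; Conj 8.2.6/8.2.8
(exponential period conjecture, Tannakian/numerical form) — the motivic shadow of crux
KZexp.KernelConjecture; Prop 12.1.5 (under 8.2.6 the algebraic closure of classical periods inside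
exponential periods is generated by Γ(q)) — the printed form of "Γ-detours are exactly the extra
content".
(2) KontsevichZagier2001 §4.3 pp.35–36 (paper:url-4812d7ce6862): definition of exponential periods
and "Conjecture 1 of §1.2 can be extended in an appropriate way" — no move list, no conservativity.
(3) arXiv:2007.08280 / 2007.08290 (Commelin–Habegger–Huber): naive = generalised naive =
cohomological exponential periods (values level; o-minimal volumes) — silent on rules and on
classical-inside-exponential.
(4) Kirby, Finitely pres  [refs: 2007.08280, 0912.4019, arxiv:2007.08280, paper:url-4812d7ce6862, FresanJossen2020, KontsevichZagier2001]

Barriers (technique_class: exp-calculus-widening syntactic-conservativity retraction): - technique_class: exp-calculus-widening syntactic-conservativity retraction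
- Literature.Barriers.KontsevichZagierPeriods.kzConjecture_implies_oddZetaAlgIndep: strength barrier
(summit ⟹ GPC-type algebraic independence of odd zeta values [HuberMullerStachPeriods2017 Prop
13.2.6, Ayoub2014 Cor 32]). APPLIES to X as a whole and is carried entirely by the conjunct
ExpKernelConjecture (stmt-0293), which mod soundness implies KZKernelConjecture; not evaded there —
the bet is that #3 is a standing hypothesis whose near-term movement is a calculus-size refutation
(no product move, one-rep boundary terms), itself informative for the definition. The crux
ExpConservativity (stmt-0292) EVADES it: it is implied by KZKernelConjecture ∧ soundness
(KZexp.conservative_of_kzKernelConjecture), asserts no numerical transcendence, and is a statement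
about two syntactic calculi attacked by retraction / normal form
(KZexp.Conservative.of_retraction_of_subset; KZexp.conservative_nlFree proved).
- Literature.Barriers.KontsevichZagierPeriods.kzConjecture_implies_twoPiI_log_algIndep: same
strength barrier (2πi and logarithms of algebraic numbers); same verdict — carried by
ExpKernelConjecture, evaded by ExpConservativity.
- Literature.Barriers.KontsevichZagierPeriods.kzConjecture_implies_ellipticPeriods_algIndep: same
strength barrier (periods of a non-CM elliptic curve); same verdict.
- Literature.Barriers.KontsevichZagierPeriods.noSemialgebraicPrimitive_inv_sub_two (Lean decl sits
in the sub-namesp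

History (route lifecycle, newest last):
- 2026-08-16T02:17:20Z · AUTO-CRUX: 1 conjecture-grade item(s) promoted to crux (ExpThesis) — refuter vetting / tiering apply (operator:999:1362873)
- 2026-08-16T14:43:05Z · LINT AUTOFIX route.multi-assembly: kept Assembly, dropped Assembly2 (gate:hygiene)
- 2026-08-23T16:53:58Z · DORMANT — reconciler: no traction for 6.1 d (last activity statement-closed at 2026-08-17T13:00:53Z); parked, not closed — `ledger route dormant route-KontsevichZagierPer (operator:999:3124595)

sub-problem: KontsevichZagierPeriods · status: dormant · opened planner-KontsevichZagierPeriods-Survey-0 2026-08-13T06:09:37Z · rev 12 · ledger route-KontsevichZagierPeriods-ExpConservative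
GENERATED by the gate from the ledger (D-0016/17). Provers cite these decls: `theorem foo : Summit.KontsevichZagierPeriods.KontsevichZagierPeriods.Theses.ExpConservative.<Decl> := …` in Summits/KontsevichZagierPeriods/KontsevichZagierPeriods/Theorems/<Name>.lean.
-/

namespace Summit.KontsevichZagierPeriods.KontsevichZagierPeriods.Theses.ExpConservative

open scoped BigOperators Topology Manifold Classical MeasureTheory ProbabilityTheory Matrix InnerProductSpace ComplexConjugate ContinuousMap
open Filter Set Function TopologicalSpace MeasureTheory

attribute [summit_statement] _root_.KontsevichZagierPeriods

open Literature Periods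

/-- item stmt-KontsevichZagierPeriods-0290 · target · rank 0 · open · by planner
why it might fail: X = ExpKernelConjecture ∧ KZexp.Conservative is, mod soundness (relations_le_ker_eval), at least KZKernelConjecture — strictly stronger than the summit: it dies with any calculus-size refutation of ExpKernelConjecture even if every period identity is KZ-derivable.
sources: Literature.KZexp.kernelConjecture_and_conservative_imp, Literature.NumberTheory.Transcendental.KZexp.kzKernelConjecture_of_conservative, FresanJossen2020 Conj 8.2.6 / Thm 5.1.1, KontsevichZagierPeriods2001 §4.3
X := ExpKZKernelConjecture ∧ Conservativity, where KZexp is the H21 KZ calculus enlarged by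
exponential weights (reps ∫_σ e^{−g} f, f g ℚ-semialgebraic, absolutely integrable; same four move
sets, Newton–Leibniz primitives in the class Σ h_i e^{g_i} with h_i, g_i ℚ-semialgebraic C¹ on an
open neighbourhood of the band), ExpKZKernelConjecture := ∀ c : KZexp.FormalRep, KZexp.eval c = 0 →
c ∈ KZexp.relations, Conservativity := ∀ c : Literature.NumberTheory.Transcendental.KZ.FormalRep,
KZexp.incl c ∈ KZexp.relations → c ∈ Literature.NumberTheory.Transcendental.KZ.relations (incl = the
obvious map g := 0). Target Lean once KZexp exists: `KZexp.KernelConjecture ∧ ∀ c :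
Literature.NumberTheory.Transcendental.KZ.FormalRep, KZexp.incl c ∈ KZexp.relations → c ∈
Literature.NumberTheory.Transcendental.KZ.relations`. [needs_definition: KZexp
(Summits/KontsevichZagierPeriods/Theorems/ExpCalculus/Basic.lean); sources: KontsevichZagier2001,
arXiv:2007.08280, BelkaleBrosnan2003] -/
@[route_item "route-KontsevichZagierPeriods-ExpConservative"]
def ExpThesis : Prop :=
  (∀ c : Literature.NumberTheory.Transcendental.KZexp.FormalRep, Literature.NumberTheory.Transcendental.KZexp.eval c = 0 → c ∈ Literature.NumberTheory.Transcendental.KZexp.relations) ∧ Literature.NumberTheory.Transcendental.KZexp.Conservative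

/-- item stmt-KontsevichZagierPeriods-0292 · crux · rank 2 · open · by planner
why it might fail: Content = weight-0 identities derived THROUGH weight≠0 reps: 1=∫₀^∞e^{−t}dt lets Γ-detours enter any identity and no coefficient retraction exists (e^{−c}∉ℚ̄; zeroLocusRetraction fails exactly on (3a)/(3b)). Mod soundness it is false only together with KZKernelConjecture (i.e. with the summit).
sources: Literature.NumberTheory.Transcendental.KZexp.Conservative, Literature.NumberTheory.Transcendental.KZexp.conservative_of_kzKernelConjecture, Literature.NumberTheory.Transcendental.KZexp.conservative_nlFree, Literature.NumberTheory.Transcendental.KZexp.Conservative.of_retraction_of_subset, FresanJossen2020 Thm 5.1.1 / Prop 5.1.3 / Cor 5.1.4 (motivic shadow only), KontsevichZagierPeriods2001 §4.3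
∀ c : Literature.NumberTheory.Transcendental.KZ.FormalRep, KZexp.incl c ∈ KZexp.relations → c ∈
Literature.NumberTheory.Transcendental.KZ.relations. Calculus analogue of full faithfulness of Nori
motives inside exponential motives (Fresán–Jossen). Hardest/most informative: it isolates exactly
what Γ-function detours buy. Attack ideas: (a) a retraction ρ : KZexp.FormalRep → KZ.FormalRep ⊗
(something) killing relations_exp and splitting incl — obstructed by 1 = ∫_0^∞ e^{−t}dt; (b)
grading/filtration by 'exponential degree' with a normal-form theorem for move sequences; (c)
motivic: perverse/irregular realisation separating classical from exponential parts. A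
counterexample c with eval c = 0 would refute KontsevichZagierPeriods itself (route Neg).
[needs_definition: KZexp; sources: arXiv:2007.08280, KontsevichZagier2001] -/
@[route_item "route-KontsevichZagierPeriods-ExpConservative", crux]
def ExpConservativity : Prop :=
  Literature.NumberTheory.Transcendental.KZexp.Conservative

/-- item stmt-KontsevichZagierPeriods-0293 · crux · rank 3 · open · by planner
why it might fail: Rules-form exponential period conjecture for THIS 5-move calculus: no product/Fubini move, one-rep NL boundary terms, so a true identity may be underivable for calculus-size reasons (first tests 0532, 0544); GPC-strength (implies KZKernelConjecture mod soundness). Torsion-free: no saturation issue.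
sources: Literature.NumberTheory.Transcendental.KZexp.KernelConjecture, Literature.NumberTheory.Transcendental.KZexp.relations_le_ker_eval, Literature.NumberTheory.Transcendental.KZexp.improperNewtonLeibnizRel, FresanJossen2020 Conj 8.2.6 / 8.2.8, Prop 12.1.5, KontsevichZagierPeriods2001 §4.3, Literature.Barriers.KontsevichZagierPeriods.kzConjecture_implies_oddZetaAlgIndep
KZexp.KernelConjecture: ∀ c : KZexp.FormalRep, KZexp.eval c = 0 → c ∈ KZexp.relations. Open
(exponential period conjecture in rules form; motivic form: Fresán–Jossen, exponential motivic
Galois group). Values covered: Literature.NumberTheory.Transcendental.exponentialPeriods ⊇ periods ∪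
{√π, Γ(p/q), γ, e} (tree facts isExponentialPeriod_sqrt_pi/gamma/eulerMascheroni). Not decomposed.
[needs_definition: KZexp; sources: KontsevichZagier2001, arXiv:2007.08280, BelkaleBrosnan2003] -/
@[route_item "route-KontsevichZagierPeriods-ExpConservative", crux]
def ExpKernelConjecture : Prop :=
  ∀ c : Literature.NumberTheory.Transcendental.KZexp.FormalRep, Literature.NumberTheory.Transcendental.KZexp.eval c = 0 → c ∈ Literature.NumberTheory.Transcendental.KZexp.relations

/-- item stmt-KontsevichZagierPeriods-0528 · support · rank 0 · open · by planner
why it might fail: X = KZexp.KernelConjecture ∧ Conservative is, mod soundness relations_le_ker_eval, at least KZKernelConjecture ∧ ExpKernel — strictly stronger than the summit: it fails if the 5-move exponential calculus is too small (0531) even when every period identity is KZ-derivable.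
sources: Literature.KZexp.kernelConjecture_and_conservative_imp, Literature.NumberTheory.Transcendental.KZexp.conservative_of_kzKernelConjecture, FresanJossen2020 Conj 8.2.6 / Thm 5.1.1, KontsevichZagier2001 §4.3
TRIGGER: def wi-03686 landed 2026-08-13T07:44Z as
Literature/NumberTheory/Transcendental/KZExpCalculus.lean (olean built; `lean search` index not yet
refreshed; elaborates rc 0 in run/shared/routes/KontsevichZagierPeriods/ExpConservative/Sketch.lean
with imports Summits.KontsevichZagierPeriods.Statement +
Literature.NumberTheory.Transcendental.KZExpCalculus). X := ker(KZexp.eval) = KZexp.relations AND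
every weight-0 combination that is an exponential relation is an ordinary KZ relation. LANDED
CALCULUS ≠ requested design in two points provers/refuters must know: (a) Newton–Leibniz has bounded
fibres a x ≤ t ≤ b x only, ONE exponential term h·e^{−g₀}, boundary recorded as two reps
[τ,h(b),g₀(b)], [τ,h(a),g₀(a)] — the half-infinite (limit-form) constructor D3(b) of addendum
wi-03872 was NOT implemented, so Γ(s+1)=sΓ(s) and even Γ(1)=1 are not evidently finite move
sequences (see rank-4 probe of this route); (b) `incl(KZ.relations) ≤ KZexp.relations` is NOT
provided and flagged 'not evidently true' by the def author (KZ NL needs only F(b)−F(a) integrable).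
Neither affects the direction X → S. [elaborates: yes (Sketch.lean rc 0); sources:
KontsevichZagier2001, arXiv:2007.08280] -/
@[route_item "route-KontsevichZagierPeriods-ExpConservative"]
def ExpThesisV2 : Prop :=
  (∀ c : Literature.NumberTheory.Transcendental.KZexp.FormalRep, Literature.NumberTheory.Transcendental.KZexp.eval c = 0 → c ∈ Literature.NumberTheory.Transcendental.KZexp.relations) ∧ Literature.NumberTheory.Transcendental.KZexp.Conservative

/-- item stmt-KontsevichZagierPeriods-0197 · support · rank 1 · closed · proved by Summit.KontsevichZagierPeriods.KernelForm.kernel_implies_statement (prover) · by planner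
sources: Summit.KontsevichZagierPeriods.KernelForm.kontsevichZagierPeriods_of_kzKernelConjecture, Literature.Periods.kzKernelConjecture_imp
Provable now, 3 lines: r.value = r'.value ⇒ eval (of r − of r') = 0 (map_sub, eval_of) ⇒ of r − of
r' ∈ relations. Every structural route (Nori, Grothendieck, ExpConservative) lands in the kernel
form; this item is the shared last step. [elaborates: yes: _survey/SketchA.lean; sources:
KontsevichZagier2001, HuberMullerStach2017] -/
@[route_item "route-KontsevichZagierPeriods-ExpConservative"]
def KernelImpliesStatement : Prop :=
  (∀ c : Literature.NumberTheory.Transcendental.KZ.FormalRep, Literature.NumberTheory.Transcendental.KZ.eval c = 0 → c ∈ Literature.NumberTheory.Transcendental.KZ.relations) → KontsevichZagierPeriods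

/-- item stmt-KontsevichZagierPeriods-0530 · support · rank 2 · open · by planner
why it might fail: Includes improper NL (3b) at weight 0 (D4): parametric weight-0 (3b) instances (Puiseux data jumping along the base) may not be KZ-derivable; weight≠0 Γ-detours (1=∫₀^∞e^{−t}) have no retraction (e^{−c}∉ℚ̄): zeroLocusRetraction fails on (3a)/(3b). Mod soundness, false only with KZKernelConjecture.
sources: Literature.NumberTheory.Transcendental.KZexp.Conservative, Literature.NumberTheory.Transcendental.KZexp.conservative_of_kzKernelConjecture, Literature.NumberTheory.Transcendental.KZexp.conservative_nlFree, Literature.NumberTheory.Transcendental.KZexp.Conservative.of_retraction_of_subset, FresanJossen2020 Thm 5.1.1 / Prop 5.1.3 / Cor 5.1.4 (motivic shadow only), KontsevichZagier2001 §4.3 p.36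
∀ c : KZ.FormalRep, KZexp.incl c ∈ KZexp.relations → c ∈ KZ.relations. Hardest/most informative. Not
vacuous in the landed calculus: bounded NL with g₀ vanishing on the graphs of a and b but not inside
the band already produces exponential intermediates from weight-0 boundary reps. Not trivially true:
the weight-0 instances of the four KZexp moves are KZ-derivable (KZexp NL at g₀=0 = KZ NL + one
integrand-additivity), so the content is exactly the detours through weight ≠ 0. Attack ideas
unchanged from 0292: normal-form/grading by exponential degree; retraction FormalRep_exp →
FormalRep_KZ ⊗ ?; motivic (Fresán–Jossen full faithfulness of classical inside exponential motives)
as heuristic only. NOTE: if the improper-NL addendum (def request filed this session) lands,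
conservativity must be re-asked for relations⁺ ⊇ relations; the present item is the weaker (fewer
exponential relations) and hence EASIER statement — settle it first. Kill: explicit c with incl c ∈
relations, c ∉ KZ.relations (filed as separate ¬ item); if moreover KZ.eval c = 0 this refutes
KontsevichZagierPeriods (route Neg). [elaborates: yes; sources: KontsevichZagier2001,
arXiv:2007.08280] -/
@[route_item "route-KontsevichZagierPeriods-ExpConservative"]
def ExpConservativityV2 : Prop :=
  Literature.NumberTheory.Transcendental.KZexp.Conservative

/-- item stmt-KontsevichZagierPeriods-0531 · support · rank 3 · open · by planner
why it might fail: Rules-form exponential period conjecture for THIS 5-move calculus: no Fubini/product move; each NL boundary term must be ONE rep (Σhᵢe^{−gᵢ}, distinct gᵢ, is not), so a true identity may be underivable for calculus-size reasons; forces saturation 2c∈rel⇒c∈rel (untested); GPC strength barrier.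
sources: Literature.NumberTheory.Transcendental.KZexp.KernelConjecture, Literature.NumberTheory.Transcendental.KZexp.relations_le_ker_eval, Literature.NumberTheory.Transcendental.KZexp.newtonLeibnizRel, FresanJossen2020 Conj 8.2.6 / 8.2.8, Prop 12.1.5, KontsevichZagier2001 §4.3 p.36, Literature.Barriers.KontsevichZagierPeriods.kzConjecture_implies_oddZetaAlgIndep
∀ c : KZexp.FormalRep, KZexp.eval c = 0 → c ∈ KZexp.relations. Open (rules form of the exponential
period conjecture; motivic form Fresán–Jossen). WARNING (planner analysis, session 64): in the
LANDED calculus (bounded-fibre NL only) this may be FALSE FOR A CALCULUS-SIZE REASON rather than a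
transcendence reason: c₀ := [(0,∞), 1, t] − [(0,1), 1, 0] has eval c₀ = ∫₀^∞e^{−t}dt − 1 = 0, and
the planner sees no finite move sequence (CoV t = s/(1−s) compactifies but the weight s/(1−s) is not
C¹ at s = 1, which NL requires on an open U ⊇ band). The rank-4 probe isolates this; if the probe is
refuted/stalls, restate this crux over relations⁺ once the improper-NL addendum lands. Not
decomposed. [elaborates: yes; sources: KontsevichZagier2001, arXiv:2007.08280, BelkaleBrosnan2003] -/
@[route_item "route-KontsevichZagierPeriods-ExpConservative"]
def ExpKernelConjectureV2 : Prop :=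
  ∀ c : Literature.NumberTheory.Transcendental.KZexp.FormalRep, Literature.NumberTheory.Transcendental.KZexp.eval c = 0 → c ∈ Literature.NumberTheory.Transcendental.KZexp.relations

/-- item stmt-KontsevichZagierPeriods-0294 · support · rank 4 · open · by planner
KZexp.Equivalent (incl r) (incl r') for the pair (r, r') of route Neg crux #2/#3 (2-dim rep on
(0,1)² with integrand x^{−8/9}(1−x)^{−5/9}y^{−4/9}(1−y)^{−2/9} vs constant 3^{7/6}/2 on the disc of
radius 2). Identity = Γ(1/9)Γ(4/9)Γ(7/9) = 2π·3^{1/6}Γ(1/3) (Gauss multiplication n = 3, z = 1/9)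
divided by Γ(4/3) = Γ(1/3)/3; numerically both sides 22.6371282948…. Expected KZexp proof: B(a,b) ↦
Γ-integrals by the CoV (x,y) ↦ (x+y, x/(x+y)) on e^{−x−y}x^{a−1}y^{b−1} (2-dim, algebraic,
injective); multiplication formula via a multiple-integral change of variables (Liouville-type
proof, Andrews–Askey–Roy §1.5) — provers must check every intermediate is absolutely convergent and
every primitive is in the exponential NL class. If this succeeds while Neg #3 stays unproved,
conservativity (#2) is pinned to a single explicit c. [needs_definition: KZexp; sources:
KontsevichZagier2001, Waldschmidt2006, Deligne1982HodgeCycles] -/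
@[route_item "route-KontsevichZagierPeriods-ExpConservative"]
def ExpTriplicationAccessible : Prop :=
  ∀ (r r' : Literature.NumberTheory.Transcendental.KZ.IntegralRep 2), r.domain = {x | ∀ i, x i ∈ Set.Ioo (0:ℝ) 1} → Set.EqOn r.integrand (fun x => (x 0) ^ (-(8:ℝ)/9) * (1 - x 0) ^ (-(5:ℝ)/9) * (x 1) ^ (-(4:ℝ)/9) * (1 - x 1) ^ (-(2:ℝ)/9)) r.domain → r'.domain = {x | x 0 ^ 2 + x 1 ^ 2 < 4} → Set.EqOn r'.integrand (fun _ => (3:ℝ) ^ ((7:ℝ)/6) / 2) r'.domain → Literature.NumberTheory.Transcendental.KZexp.Equivalent (Literature.NumberTheory.Transcendental.KZexp.ofKZ r) (Literature.NumberTheory.Transcendental.KZexp.ofKZ r')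

/-- item stmt-KontsevichZagierPeriods-0532 · support · rank 4 · open · by planner
sources: Literature.NumberTheory.Transcendental.KZexp.improperNewtonLeibnizRel, Literature.NumberTheory.Transcendental.KZexp.newtonLeibnizRel
The atom of every Γ-function detour (introducing a factor ∫₀^∞e^{−t}dt = 1 next to a period, Γ(s+1)
= sΓ(s), Beta–Gamma, Gauss multiplication) is integration to +∞ against e^{−t}. The landed
KZexp.newtonLeibnizRel has bounded fibres a x ≤ t ≤ b x with h, g₀ C¹ semialgebraic on an open U ⊇
band; addendum wi-03872 D3(b) (half-infinite fibres in limit form) was not implemented. QUESTION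
made checkable: is ∫₀^∞ e^{−t}dt = ∫₀¹ 1 nevertheless a finite consequence of the four landed moves?
Planner's failed attempts: CoV t = s/(1−s) then NL on [0,1] (weight not C¹ at s=1); CoV t = 1/s on
[1,∞) (weight 1/s at s=0); extra base variable with fibre 0 ≤ t ≤ x (reduces to the same improper
integral in x). A consequence of 0293′ (values agree) and a prerequisite of triplication-in-KZexp
(rank 6). OUTCOMES: proved → the landed calculus is strong enough, keep 0292′/0293′ as filed and
attack rank 6 over it; refuted (an additive invariant of the four landed move sets separating the
two reps) or checked-stalled with refuter verdict 'needs improper NL' → the def addendum (improper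
NL, filed this session) becomes load-bearing and 0292′/0293′ get relations⁺ successors. Either
outcome is informative; est. -/
@[route_item "route-KontsevichZagierPeriods-ExpConservative"]
def ExpGammaOneProbe : Prop :=
  ∀ (r₁ r₀ : Literature.NumberTheory.Transcendental.KZexp.IntegralRep 1), r₁.domain = {x | 0 < x 0} → Set.EqOn r₁.integrand (fun _ => 1) r₁.domain → Set.EqOn r₁.weight (fun x => x 0) r₁.domain → r₀.domain = {x | x 0 ∈ Set.Ioo (0:ℝ) 1} → Set.EqOn r₀.integrand (fun _ => 1) r₀.domain → Set.EqOn r₀.weight (fun _ => 0) r₀.domain → Literature.NumberTheory.Transcendental.KZexp.Equivalent r₁ r₀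

/-- item stmt-KontsevichZagierPeriods-0544 · support · rank 4 · open · by planner
why it might fail: Every Γ-based move chain leaves a non-unit Γ-factor rep tensored on; removing it is π- /Γ-cancellation in KZexp (KernelConjecture-strength at this c), not a move — no chain may exist though the values agree (GaussMultiplicationFormula n=3, z=1/9).
sources: Literature.Analysis.SpecialFunctions.GaussMultiplicationFormula, AndrewsAskeyRoy1999 Thm 1.5.2, Literature.NumberTheory.Transcendental.KZexp.improperNewtonLeibnizRel, Literature.NumberTheory.Transcendental.KZexp.changeOfVariablesRel, KontsevichZagierPeriods2001 §4.3, refuter rreview1 note on stmt-0544 (2026-08-15): proof-path gap = π-cancellation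
Same pair as Neg 0311/0312 and as informal 0534 (session 64), now with a Lean signature because the
blocking definition landed: the revised KZExpCalculus.lean (wi-03872 → p3126) puts the improper
half-infinite Newton–Leibniz move (3b) `improperNewtonLeibnizRel` (primitive F = expSum h g = Σ
hᵢe^{−gᵢ}, limit hypothesis F(x,t)→0) into `Literature.NumberTheory.Transcendental.KZexp.relations`,
so Γ(1)=1, Γ(s+1)=sΓ(s) and the Liouville/Gauss-multiplication multiple-integral CoV are finite move
sequences in principle. CLAIM: [(0,1)², x^{−8/9}(1−x)^{−5/9}y^{−4/9}(1−y)^{−2/9}, 0] ~ [{x²+y²<4},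
3^{7/6}/2, 0] in KZexp (values: B(1/9,4/9)B(5/9,7/9) = 2·3^{7/6}π by Gauss multiplication n=3 at 1/9
and reflexion). PROOF PATH (each arrow = finitely many of the 5 moves; provers must exhibit them):
(i) B(a,b)·Γ(a+b) ~ Γ(a)Γ(b) by the single CoV (u,v)↦(uv,u(1−v)) on (0,∞)×(0,1) [calibration 0533];
(ii) Γ-factors are introduced from nothing only multiplicatively: every move tensored with a fixed
rep [ρ] is again a move (domain product, weight g⊕g_ρ), so a relation c ∈ relations gives c×[ρ] ∈
relations — use ρ = Γ(2/3)-rep etc.; (iii) Gauss multiplication Γ(3s)(2π)·3^{1/2−3s} =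
Γ(s)Γ(s+1/3)Γ(s+2/3) at -/
@[route_item "route-KontsevichZagierPeriods-ExpConservative"]
def ExpTriplicationAccessibleV3 : Prop :=
  ∀ (r r' : Literature.NumberTheory.Transcendental.KZ.IntegralRep 2), r.domain = {x | ∀ i, x i ∈ Set.Ioo (0:ℝ) 1} → Set.EqOn r.integrand (fun x => (x 0) ^ (-(8:ℝ)/9) * (1 - x 0) ^ (-(5:ℝ)/9) * (x 1) ^ (-(4:ℝ)/9) * (1 - x 1) ^ (-(2:ℝ)/9)) r.domain → r'.domain = {x | x 0 ^ 2 + x 1 ^ 2 < 4} → Set.EqOn r'.integrand (fun _ => (3:ℝ) ^ ((7:ℝ)/6) / 2) r'.domain → Literature.NumberTheory.Transcendental.KZexp.Equivalent (Literature.NumberTheory.Transcendental.KZexp.ofKZ r) (Literature.NumberTheory.Transcendental.KZexp.ofKZ r')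

/-- item stmt-KontsevichZagierPeriods-0295 · support · rank 5 · open · by planner
KZexp.Equivalent between the 3-dim rep ∫_{(0,1)×(0,∞)²}… no: state as FormalRep identity [∫∫_{x,y>0}
e^{−x−y} x^{−2/3} y^{−2/3}] − [∫∫_{u>0, 0<v<1} e^{−u} u^{−1/3} (v(1−v))^{−2/3}] ∈ KZexp.relations
via the single change of variables (x,y) = (uv, u(1−v)) (Jacobian u), then Fubini-free: the second
rep IS a product domain so no further move is needed to call it Γ(2/3)·B(1/3,1/3) — the identity of
VALUES with Γ(1/3)² is eval, not a move. Exercises changeOfVariablesRel side conditions with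
exponential weights. [needs_definition: KZexp; sources: KontsevichZagier2001] -/
@[route_item "route-KontsevichZagierPeriods-ExpConservative"]
def ExpBetaGammaCalibration : Prop :=
  ∀ (r₁ r₂ : Literature.NumberTheory.Transcendental.KZexp.IntegralRep 2), r₁.domain = {x | ∀ i, 0 < x i} → Set.EqOn r₁.integrand (fun x => (x 0) ^ (-(2:ℝ)/3) * (x 1) ^ (-(2:ℝ)/3)) r₁.domain → Set.EqOn r₁.weight (fun x => x 0 + x 1) r₁.domain → r₂.domain = {x | 0 < x 0 ∧ x 1 ∈ Set.Ioo (0:ℝ) 1} → Set.EqOn r₂.integrand (fun x => (x 0) ^ (-(1:ℝ)/3) * (x 1 * (1 - x 1)) ^ (-(2:ℝ)/3)) r₂.domain → Set.EqOn r₂.weight (fun x => x 0) r₂.domain → Literature.NumberTheory.Transcendental.KZexp.Equivalent r₁ r₂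

/-- item stmt-KontsevichZagierPeriods-0533 · support · rank 5 · open · by planner
sources: Literature.NumberTheory.Transcendental.KZexp.changeOfVariablesRel
r₁ = [(0,∞)², x^{−2/3}y^{−2/3}, x+y] (value Γ(1/3)²), r₂ = [(0,∞)×(0,1), u^{−1/3}(v(1−v))^{−2/3}, u]
(value Γ(2/3)B(1/3,1/3)). Expected: ONE move, of r₂ − of r₁ ∈ KZexp.changeOfVariablesRel with Φ(u,v)
= (uv, u(1−v)) : r₂.domain → r₁.domain, polynomial (hence IsSemialgebraicMapOn ℚ), injective, |det
Φ′| = u, r₂.integrand = r₁.integrand ∘ Φ · u ✓, r₂.weight = r₁.weight ∘ Φ ✓, image = open quadrant ✓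
(inverse u = x+y, v = x/(x+y)). Unaffected by the missing improper-NL move. Exercises the
exponential CoV side conditions (HasFDerivWithinAt on an open set, InjOn, image equality); est.
100–250 lines, mostly the image computation. Integrability is bundled in the IntegralRep hypotheses.
[elaborates: yes; sources: KontsevichZagier2001] -/
@[route_item "route-KontsevichZagierPeriods-ExpConservative"]
def ExpBetaGammaCalibrationV2 : Prop :=
  ∀ (r₁ r₂ : Literature.NumberTheory.Transcendental.KZexp.IntegralRep 2), r₁.domain = {x | ∀ i, 0 < x i} → Set.EqOn r₁.integrand (fun x => (x 0) ^ (-(2:ℝ)/3) * (x 1) ^ (-(2:ℝ)/3)) r₁.domain → Set.EqOn r₁.weight (fun x => x 0 + x 1) r₁.domain → r₂.domain = {x | 0 < x 0 ∧ x 1 ∈ Set.Ioo (0:ℝ) 1} → Set.EqOn r₂.integrand (fun x => (x 0) ^ (-(1:ℝ)/3) * (x 1 * (1 - x 1)) ^ (-(2:ℝ)/3)) r₂.domain → Set.EqOn r₂.weight (fun x => x 0) r₂.domain → Literature.NumberTheory.Transcendental.KZexp.Equivalent r₁ r₂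

/-- item stmt-KontsevichZagierPeriods-0534 · support · rank 6 · open · by planner
Target shape over the LANDED calculus elaborates (Sketch.lean rc 0): `∀ (r r' :
Literature.NumberTheory.Transcendental.KZ.IntegralRep 2), r.domain = {x | ∀ i, x i ∈ Set.Ioo (0:ℝ)
1} → Set.EqOn r.integrand (fun x => (x 0) ^ (-(8:ℝ)/9) * (1 - x 0) ^ (-(5:ℝ)/9) * (x 1) ^ (-(4:ℝ)/9)
* (1 - x 1) ^ (-(2:ℝ)/9)) r.domain → r'.domain = {x | x 0 ^ 2 + x 1 ^ 2 < 4} → Set.EqOn r'.integrand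
(fun _ => (3:ℝ) ^ ((7:ℝ)/6) / 2) r'.domain → Literature.NumberTheory.Transcendental.KZexp.Equivalent
(Literature.NumberTheory.Transcendental.KZexp.ofKZ r)
(Literature.NumberTheory.Transcendental.KZexp.ofKZ r')` (same pair as Neg 0311/0312). NOT filed with
that signature because every known proof (Beta–Gamma CoV ×2, Gauss multiplication n=3 via
Liouville-type multiple-integral CoV [Andrews–Askey–Roy §1.5], Γ(4/3) = Γ(1/3)/3, and the very first
step of adjoining Γ-factors to a period) integrates to +∞ against e^{−t}, which the landed
bounded-fibre NL does not evidently provide (rank-4 probe). File-able with a Lean signature once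
EITHER the rank-4 probe is PROVED (then use the shape above verbatim, KZexp.Equivalent) OR the
improper-NL def addendum lands (then replace Equivalent by its relations⁺ analogue). Addi -/
@[route_item "route-KontsevichZagierPeriods-ExpConservative"]
def ExpTriplicationAccessibleV2 : Prop :=
  ∀ (r r' : Literature.NumberTheory.Transcendental.KZ.IntegralRep 2), r.domain = {x | ∀ i, x i ∈ Set.Ioo (0:ℝ) 1} → Set.EqOn r.integrand (fun x => (x 0) ^ (-(8:ℝ)/9) * (1 - x 0) ^ (-(5:ℝ)/9) * (x 1) ^ (-(4:ℝ)/9) * (1 - x 1) ^ (-(2:ℝ)/9)) r.domain → r'.domain = {x | x 0 ^ 2 + x 1 ^ 2 < 4} → Set.EqOn r'.integrand (fun _ => (3:ℝ) ^ ((7:ℝ)/6) / 2) r'.domain → Literature.NumberTheory.Transcendental.KZexp.Equivalent (Literature.NumberTheory.Transcendental.KZexp.ofKZ r) (Literature.NumberTheory.Transcendental.KZexp.ofKZ r')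

/-- item stmt-KontsevichZagierPeriods-0535 · support · rank 7 · open · by planner
sources: Literature.NumberTheory.Transcendental.KZexp.conservative_of_kzKernelConjecture, Literature.NumberTheory.Transcendental.KZexp.relations_le_ker_eval
Negative side of crux 2′, filed so the refutation direction is staffed. A witness c needs a proof
that c ∉ KZ.relations, i.e. an additive invariant of the four KZ move sets (cf. Neg 0313 obstruction
shape) that does not extend to the exponential moves. If the witness also has KZ.eval c = 0 it
refutes KontsevichZagierPeriods (hand to route Neg); if KZ.eval c ≠ 0 it refutes KZexp soundness
`KZexp.relations_le_ker_eval` instead — so a prover here should first discharge/assume soundness: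
realistically this item is `KZexp.relations_le_ker_eval → ¬Conservative →
¬KontsevichZagierPeriods`-shaped information. Closing this item positively closes route
ExpConservative. [elaborates: yes; sources: KontsevichZagier2001] -/
@[route_item "route-KontsevichZagierPeriods-ExpConservative"]
def ExpNotConservative : Prop :=
  ¬ Literature.NumberTheory.Transcendental.KZexp.Conservative

/-- item stmt-KontsevichZagierPeriods-14444 · support · rank 9 · closed · proved by Summit.KontsevichZagierPeriods.ExpConservative.expThesisGlue_proof @ 41111289aa13 (prover) · by planner
[support] glue of the target: the two cruxes consumed by the deciding theorem give the thesis X =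
ExpKernelConjecture ∧ Conservative, i.e. ExpConservativity → ExpKernelConjecture → ExpThesis.
Definitional — ExpThesis unfolds to (∀ c : KZexp.FormalRep, KZexp.eval c = 0 → c ∈ KZexp.relations)
∧ KZexp.Conservative, ExpConservativity to KZexp.Conservative, ExpKernelConjecture to the first
conjunct; proof term `fun h₁ h₂ => ⟨h₂, h₁⟩` (planner Sketch.lean rc0, std axioms). Filed to clear
the route-choice hold target-unreachable (ExpThesis); no mathematical content. [glue] [deps:
ExpConservativity, ExpKernelConjecture, ExpThesis] [difficulty: provable-now] -/
@[route_item "route-KontsevichZagierPeriods-ExpConservative"]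
def ExpThesisGlue : Prop :=
  ExpConservativity → ExpKernelConjecture → ExpThesis

/-- item stmt-KontsevichZagierPeriods-0291 · assembly · rank 1 · closed · proved by Summit.KontsevichZagierPeriods.ExpConservative.assembly_proof @ 4287ea13ab44 (prover) · by planner
KZ.eval c = 0 ⇒ KZexp.eval (incl c) = 0 (incl commutes with eval) ⇒ incl c ∈ KZexp.relations
(ExpKernel) ⇒ c ∈ KZ.relations (Conservativity) ⇒
Literature.NumberTheory.Transcendental.KZKernelConjecture ⇒ statement by
stmt-KontsevichZagierPeriods-0197. Needs KZexp. [needs_definition: KZexp; sources: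
KontsevichZagier2001] -/
@[route_item "route-KontsevichZagierPeriods-ExpConservative"]
def Assembly : Prop :=
  (∀ c : Literature.NumberTheory.Transcendental.KZexp.FormalRep, Literature.NumberTheory.Transcendental.KZexp.eval c = 0 → c ∈ Literature.NumberTheory.Transcendental.KZexp.relations) ∧ Literature.NumberTheory.Transcendental.KZexp.Conservative → KontsevichZagierPeriods

-- records of items no longer active in this route (dropped / restated):
-- earlier Assembly2 (stmt-KontsevichZagierPeriods-0529, dropped 2026-08-16T14:43:05Z): moot by None — (∀ c : Literature.NumberTheory.Transcendental.KZexp.FormalRep, Literature.NumberTheory.Transcendental.KZexp.eval c = 0 → c ∈ Literature.NumberTheory.Transcendental.KZexp.relations) ∧ Literature.NumberTheory.Transcendental.KZexp.Conservative → KontsevichZagierPeriods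

/-! D-0027 §2.1 — DECIDING THEOREM (planner-authored via `route open/edit --closes-file`; by planner-rconj-KontsevichZagierPeriods-ExpCons-de43da18-0 2026-08-15T18:18:28Z):
its hypotheses are this route's items and its conclusion the sub-problem Statement (glue_lint), and it elaborates with this file. -/

/-- Route glue (D-0027 §2.1), route KontsevichZagierPeriods/ExpConservative, direct form: given
`r.value = r'.value`, the goal `KZ.Equivalent r r'` is `[r] − [r'] ∈ KZ.relations`; conservativity
(`ExpConservativity` = `KZexp.Conservative`) reduces it to `incl ([r] − [r']) ∈ KZexp.relations`, the
exponential kernel conjecture (`ExpKernelConjecture`) to `KZexp.eval (incl ([r] − [r'])) = 0`, and values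
are preserved (`KZexp.eval_incl`), so this is `KZ.eval ([r] − [r']) = r.value − r'.value = 0`
(`map_sub`, `KZ.eval_of`). No detour through the named statement `KZKernelConjecture`; the rationality
hypotheses are not used. -/
@[closes "route-KontsevichZagierPeriods-ExpConservative"] theorem closes (h₁ : ExpConservativity) (h₂ : ExpKernelConjecture) : KontsevichZagierPeriods := by
  intro n m r r' _ _ hv
  apply h₁
  apply h₂
  rw [Literature.NumberTheory.Transcendental.KZexp.eval_incl]
  simp [Literature.NumberTheory.Transcendental.KZ.eval_of, hv]

end Summit.KontsevichZagierPeriods.KontsevichZagierPeriods.Theses.ExpConservative
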